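import Literature.Probability.LatticeModels.StrongHarrisKleitman
import Literature.Probability.Percolation.SahiSunflowerSeparation
import HarnessLib

/-!
# `NoHeavyLowerTail` (crux stmt-CriticalPhenomena-4575), abstract sunflower cubic: the PRINCIPAL-CORE stratum —
# Lemma A `Π_i μ(V_i) ≤ μ(A)^{k−1}` holds UNCONDITIONALLY when the core `A` is a principal filter, hence the payer
# dichotomy (C1-law), the `H`/`G`/`T` rows and Kahn's Conjecture 5 on the complements, for every such sunflower

Support file (seat `prim-ineq-prove-1` gen 34; `--supports stmt-CriticalPhenomena-4575`).  Nothing is asserted about the crux; no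
`sorry`, no named facts, standard axioms.  Memo: run/shared/lean/prim/prim-ineq-prove-1/FINDING-PRINCIPALCORE-prove1-g34.md.

SETTING.  `μ = prodBernoulli p` on `Set ι` (each coordinate `i` present independently with probability `p i`; `ι` arbitrary for
the main theorem, finite for the cell-level corollaries).  A SUNFLOWER of up-sets is a family of increasing events `V i` whose
pairwise intersections all equal the CORE `A`; cells `a = μ A`, petals `c_i = μ (V_i ∖ A)`, bottom `b = μ (⋃ V_i)ᶜ`, `v_i = μ V_i = a + c_i`.
The lane's conjecture (C1-law) (prove-1 g29; = prim-ineq-gen-2's GW for `W_i := V_j ∪ V_k`) is the dichotomy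
`max(a,b)·(ab − e₂(c)) ≥ e₃(c)`; its `A`-half ("Lemma A", `a(ab − e₂) ≥ e₃ ⟺ v₁v₂v₃ ≤ a²`) is conjectured under `a ≥ b` and is
an identity on every star-type composition; proved so far for 3-block chain structures (g33, `ChainCert.e3_le_max_mul_AG_three_blocks'`).

THIS FILE: the stratum where the core is a PRINCIPAL FILTER `A = {ω | g ⊆ ω}` (`g` a finite set of coordinates) — there Lemma A needs
NO density hypothesis and NO sunflower equality, only `V_i ∩ V_j ⊆ {g ⊆ ω}`:

* `PrincipalCore.prod_real_le_prod_pow` — for up-sets `V i` (`i : κ`, `κ` finite) with `V i ∩ V j ⊆ {ω | g ⊆ ω}` (`i ≠ j`):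
  `∏_i μ(V i) ≤ (∏_{e ∈ g} p e)^{|κ| − 1} = μ{g ⊆ ω}^{|κ|−1}` (`prod_real_le_real_core_pow`).
  PROOF (five lines, "disjoint missing supports"): if `ω ∈ V i` and `ω' ∈ V j` (`i ≠ j`) both miss a coordinate `e ∈ g` then so does
  `ω ∪ ω' ∈ V i ∩ V j ⊆ {g ⊆ ω}` — impossible (`mem_or_mem`); so every `e ∈ g` is contained in ALL members of `V i` for all but at
  most one `i` (`card_filter_not_keeps_le_one`), `V i ⊆ {kept_i ⊆ ω}` with `μ{kept_i ⊆ ω} = ∏_{e ∈ kept_i} p e`, and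
  `∏_i ∏_{e ∈ kept_i} p e = ∏_{e∈g} (p e)^{#{i : e kept}} ≤ ∏_{e ∈ g} (p e)^{|κ|−1}`.  For `|κ| = 2` this is Harris' `μ(V₁)μ(V₂) ≤ μ(V₁ ∩ V₂)`
  (when the intersection is the principal filter); for `|κ| = 3` it is Lemma A; in general it is the `k`-set ladder.
* `gwLadder_of_principalCap`, `gw_of_principalCap` — prim-ineq-gen-2's GW in its own form: for up-sets `W i` with `⋂ W = {g ⊆ ω}`,
  `∏_i μ(⋂_{j≠i} W j) ≤ μ(⋂ W)^{|κ|−1}`; three sets: `μ(W₁W₂)μ(W₁W₃)μ(W₂W₃) ≤ μ(W₁W₂W₃)²` — unconditionally on the principal-cap stratum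
  (gen-2 g17 memo GW-FMAX-COMBM §1 lists the proved cases `some W_i principal / Ω / nested / disjoint supports`; this one is new).
* `lemmaA_of_principalCore` — `μ(E₁)μ(E₂)μ(E₃) ≤ μ(A)²` for every three-petal sunflower of up-sets with principal core; in cells
  (`ι` finite): `e3_le_core_mul_AG` (`c₁c₂c₃ ≤ a(ab − e₂)`), hence the dichotomy `e3_le_max_mul_AG` ((C1-law)), the `H`-row
  `lawH_nonneg` (`(a+b)(ab−e₂) ≥ e₃`), the `G`-row `AG_ge_e3` (`ab − e₂ ≥ e₃`, as `a ≤ 1`), and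
  `sahiE3_compl_nonneg_of_principalCore` — KAHN'S CONJECTURE 5 / Sahi `E₃ ≥ 0` for the three DEcreasing events `E_iᶜ`
  (`E₃(E₁ᶜ,E₂ᶜ,E₃ᶜ) = (1+a)(ab−e₂) − e₃`, `Literature…sahiE3_compl_sunflower_eq`; the tree had `≥ −e₃` for every sunflower,
  `prodBernoulli_sahiE3_compl_sunflower_ge`).  Complementary to prim-masterthm's principal-cap `C₃` (`E₃(A,B,C) ≥ 0` for INcreasing
  `A,B,C` with principal triple intersection, `SahiMasterFamilyPrincipalCapC3`): here the decreasing triple `E_iᶜ` has triple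
  intersection `b`-cell, which is not principal.
* DUAL (companion file `…SunflowerPrincipalBottom`, reflection `ω ↦ ωᶜ`, `p ↦ 1 − p`): down-sets with pairwise intersections inside a
  principal IDEAL satisfy the mirror bound; for a sunflower whose BOTTOM cell is a principal ideal this is Lemma B unconditionally.
So on the principal-core and principal-bottom strata every law-level row of the lane (Lemma A resp. B, (C1-law), `H`, `G`, `T`,
Kahn-5-on-complements) is a theorem for all `p`; the general case (core with ≥ 2 minimal elements) is where the density hypothesis
`a ≥ b` becomes necessary (product type: core = majority of three atoms, `a·AG < e₃` for small `p`).
-/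

noncomputable section

namespace Summit.CriticalPhenomena.PercolationContinuityZ3.Theorems.SunflowerPartition

namespace PrincipalCore

open MeasureTheory Finset
open Literature.Probability.LatticeModels

variable {ι : Type*} {κ : Type*}

/-! ## The combinatorial core: disjoint missing supports -/

/-- **Key observation.**  If the up-sets `V i` have pairwise intersections inside the principal filter of `g`, then two members
of DIFFERENT `V i`, `V j` cannot both miss a coordinate `e ∈ g` (their union would lie in `V i ∩ V j` and miss `e`). [this work] -/
theorem mem_or_mem {V : κ → Set (Set ι)} (hV : ∀ i, IsUpperSet (V i)) {g : Finset ι}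
    (hcap : ∀ i j, i ≠ j → V i ∩ V j ⊆ {ω | (g : Set ι) ⊆ ω}) {i j : κ} (hij : i ≠ j)
    {ω ω' : Set ι} (hω : ω ∈ V i) (hω' : ω' ∈ V j) {e : ι} (he : e ∈ g) : e ∈ ω ∨ e ∈ ω' := by
  have h1 : ω ∪ ω' ∈ V i := hV i Set.subset_union_left hω
  have h2 : ω ∪ ω' ∈ V j := hV j Set.subset_union_right hω'
  have h3 : (g : Set ι) ⊆ ω ∪ ω' := hcap i j hij ⟨h1, h2⟩
  exact h3 (Finset.mem_coe.2 he)

open scoped Classical in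
/-- Every member of `V i` contains all coordinates of `g` KEPT by `V i` (those lying in every member of `V i`):
`V i ⊆ {ω | kept ⊆ ω}` with `kept = g.filter (∀ ω ∈ V i, · ∈ ω)`. [this work] -/
theorem subset_setOf_kept (V : κ → Set (Set ι)) (g : Finset ι) (i : κ) :
    V i ⊆ {ω | ((g.filter fun e => ∀ ω ∈ V i, e ∈ ω : Finset ι) : Set ι) ⊆ ω} := by
  intro ω hω e he
  have he' := Finset.mem_coe.1 he
  rw [Finset.mem_filter] at he'
  exact he'.2 ω hω

open scoped Classical in
/-- Hence `μ(V i) ≤ ∏_{e ∈ kept_i} p e`. [this work] -/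
theorem real_le_prod_kept (p : ι → unitInterval) (V : κ → Set (Set ι)) (g : Finset ι) (i : κ) :
    (prodBernoulli p).real (V i) ≤ ∏ e ∈ (g.filter fun e => ∀ ω ∈ V i, e ∈ ω), (p e : ℝ) := by
  rw [← prodBernoulli_real_subset]
  exact measureReal_mono (subset_setOf_kept V g i)

open scoped Classical in
/-- At most one index fails to keep a given coordinate `e ∈ g`. [this work] -/
theorem card_filter_not_keeps_le_one [Fintype κ] {V : κ → Set (Set ι)} (hV : ∀ i, IsUpperSet (V i))
    {g : Finset ι} (hcap : ∀ i j, i ≠ j → V i ∩ V j ⊆ {ω | (g : Set ι) ⊆ ω}) {e : ι} (he : e ∈ g) :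
    (Finset.univ.filter fun i => ¬ ∀ ω ∈ V i, e ∈ ω).card ≤ 1 := by
  rw [Finset.card_le_one]
  intro i hi j hj
  rw [Finset.mem_filter] at hi hj
  by_contra hij
  have hi' := hi.2
  have hj' := hj.2
  push Not at hi' hj'
  obtain ⟨ω, hω, heω⟩ := hi'
  obtain ⟨ω', hω', heω'⟩ := hj'
  rcases mem_or_mem hV hcap hij hω hω' he with h | h
  · exact heω h
  · exact heω' h

open scoped Classical in
/-- For a fixed `e ∈ g`: `∏_i (p e if kept else 1) ≤ (p e)^{|κ|−1}`. [this work] -/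
theorem prod_ite_le_pow [Fintype κ] (p : ι → unitInterval) {V : κ → Set (Set ι)}
    (hV : ∀ i, IsUpperSet (V i)) {g : Finset ι} (hcap : ∀ i j, i ≠ j → V i ∩ V j ⊆ {ω | (g : Set ι) ⊆ ω})
    {e : ι} (he : e ∈ g) :
    ∏ i, (if (∀ ω ∈ V i, e ∈ ω) then (p e : ℝ) else 1) ≤ (p e : ℝ) ^ (Fintype.card κ - 1) := by
  rw [Finset.prod_ite, Finset.prod_const_one, mul_one, Finset.prod_const]
  have h1 := card_filter_not_keeps_le_one hV hcap he
  have h2 := Finset.card_filter_add_card_filter_not (s := (Finset.univ : Finset κ)) (fun i => ∀ ω ∈ V i, e ∈ ω)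
  rw [Finset.card_univ] at h2
  exact pow_le_pow_of_le_one (p e).2.1 (p e).2.2 (by omega)

/-! ## The main theorem -/

/-- **Principal-core theorem.**  For `μ = prodBernoulli p` on `Set ι` and up-sets `V i` (`i` in a finite index type `κ`) whose
pairwise intersections are contained in the principal filter `{ω | g ⊆ ω}` of a finite set `g` of coordinates:
`∏_i μ(V i) ≤ (∏_{e ∈ g} p e)^{|κ| − 1}`.  No density hypothesis, no measurability, `ι` arbitrary. [this work] -/
theorem prod_real_le_prod_pow [Fintype κ] (p : ι → unitInterval) {V : κ → Set (Set ι)} (hV : ∀ i, IsUpperSet (V i))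
    (g : Finset ι) (hcap : ∀ i j, i ≠ j → V i ∩ V j ⊆ {ω | (g : Set ι) ⊆ ω}) :
    ∏ i, (prodBernoulli p).real (V i) ≤ (∏ e ∈ g, (p e : ℝ)) ^ (Fintype.card κ - 1) := by
  classical
  calc ∏ i, (prodBernoulli p).real (V i)
      ≤ ∏ i, ∏ e ∈ (g.filter fun e => ∀ ω ∈ V i, e ∈ ω), (p e : ℝ) :=
        Finset.prod_le_prod (fun i _ => measureReal_nonneg) fun i _ => real_le_prod_kept p V g i
    _ = ∏ i, ∏ e ∈ g, (if (∀ ω ∈ V i, e ∈ ω) then (p e : ℝ) else 1) := by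
        refine Finset.prod_congr rfl fun i _ => ?_
        rw [Finset.prod_filter]
    _ = ∏ e ∈ g, ∏ i, (if (∀ ω ∈ V i, e ∈ ω) then (p e : ℝ) else 1) := Finset.prod_comm
    _ ≤ ∏ e ∈ g, (p e : ℝ) ^ (Fintype.card κ - 1) := by
        refine Finset.prod_le_prod (fun e _ => Finset.prod_nonneg fun i _ => ?_) fun e he => prod_ite_le_pow p hV hcap he
        split_ifs
        · exact (p e).2.1
        · exact zero_le_one
    _ = (∏ e ∈ g, (p e : ℝ)) ^ (Fintype.card κ - 1) := Finset.prod_pow g _ _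

/-- The same with the right-hand side written as a power of the measure of the principal filter. [this work] -/
theorem prod_real_le_real_core_pow [Fintype κ] (p : ι → unitInterval) {V : κ → Set (Set ι)} (hV : ∀ i, IsUpperSet (V i))
    (g : Finset ι) (hcap : ∀ i j, i ≠ j → V i ∩ V j ⊆ {ω | (g : Set ι) ⊆ ω}) :
    ∏ i, (prodBernoulli p).real (V i) ≤ ((prodBernoulli p).real {ω | (g : Set ι) ⊆ ω}) ^ (Fintype.card κ - 1) := by
  rw [prodBernoulli_real_subset]
  exact prod_real_le_prod_pow p hV g hcap

/-! ## GW on the principal cap (prim-ineq-gen-2's formulation) -/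

/-- **GW `k`-set ladder on the principal cap.**  For up-sets `W i` (`i : κ`, finite) whose total intersection is the principal
filter of `g`: `∏_i μ(⋂_{j ≠ i} W j) ≤ μ(⋂_i W i)^{|κ| − 1}`, with no density hypothesis. [this work] -/
theorem gwLadder_of_principalCap [Fintype κ] (p : ι → unitInterval) {W : κ → Set (Set ι)} (hW : ∀ i, IsUpperSet (W i))
    (g : Finset ι) (hcap : (⋂ i, W i) = {ω | (g : Set ι) ⊆ ω}) :
    ∏ i, (prodBernoulli p).real (⋂ j ∈ ({i}ᶜ : Set κ), W j) ≤ ((prodBernoulli p).real (⋂ i, W i)) ^ (Fintype.card κ - 1) := by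
  classical
  have hV : ∀ i, IsUpperSet (⋂ j ∈ ({i}ᶜ : Set κ), W j) := fun i =>
    isUpperSet_iInter₂ fun j _ => hW j
  have hcap' : ∀ i l, i ≠ l → (⋂ j ∈ ({i}ᶜ : Set κ), W j) ∩ (⋂ j ∈ ({l}ᶜ : Set κ), W j) ⊆ {ω | (g : Set ι) ⊆ ω} := by
    intro i l hil ω hω
    rw [← hcap, Set.mem_iInter]
    intro j
    obtain ⟨h1, h2⟩ := hω
    rw [Set.mem_iInter₂] at h1 h2
    by_cases hji : j = i
    · subst hji
      exact h2 j (by simpa using hil)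
    · exact h1 j (by simpa using hji)
  rw [hcap, prodBernoulli_real_subset]
  exact prod_real_le_prod_pow p hV g hcap'

/-- **GW on the principal cap, three sets.**  For up-sets `W₁ W₂ W₃` with `W₁ ∩ W₂ ∩ W₃ = {g ⊆ ω}`:
`μ(W₁∩W₂) μ(W₁∩W₃) μ(W₂∩W₃) ≤ μ(W₁∩W₂∩W₃)²`. [this work] -/
theorem gw_of_principalCap (p : ι → unitInterval) {W₁ W₂ W₃ : Set (Set ι)} (h₁ : IsUpperSet W₁) (h₂ : IsUpperSet W₂)
    (h₃ : IsUpperSet W₃) (g : Finset ι) (hcap : W₁ ∩ W₂ ∩ W₃ = {ω | (g : Set ι) ⊆ ω}) :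
    (prodBernoulli p).real (W₁ ∩ W₂) * (prodBernoulli p).real (W₁ ∩ W₃) * (prodBernoulli p).real (W₂ ∩ W₃) ≤
      ((prodBernoulli p).real (W₁ ∩ W₂ ∩ W₃)) ^ 2 := by
  let V : Fin 3 → Set (Set ι) := ![W₂ ∩ W₃, W₁ ∩ W₃, W₁ ∩ W₂]
  have hV : ∀ i, IsUpperSet (V i) := by
    intro i; fin_cases i
    · exact h₂.inter h₃
    · exact h₁.inter h₃
    · exact h₁.inter h₂
  have hcap' : ∀ i j, i ≠ j → V i ∩ V j ⊆ {ω | (g : Set ι) ⊆ ω} := by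
    intro i j hij ω hω
    rw [← hcap]
    fin_cases i <;> fin_cases j
    all_goals first
      | exact (hij rfl).elim
      | (simp only [V] at hω
         obtain ⟨⟨ha, hb⟩, ⟨hc, hd⟩⟩ := hω
         refine ⟨⟨?_, ?_⟩, ?_⟩ <;> assumption)
  have key := prod_real_le_prod_pow p hV g hcap'
  rw [Fin.prod_univ_three] at key
  simp only [V, Matrix.cons_val_zero, Matrix.cons_val_one, Matrix.cons_val, Fintype.card_fin] at key
  rw [hcap, prodBernoulli_real_subset]
  calc (prodBernoulli p).real (W₁ ∩ W₂) * (prodBernoulli p).real (W₁ ∩ W₃) * (prodBernoulli p).real (W₂ ∩ W₃)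
      = (prodBernoulli p).real (W₂ ∩ W₃) * (prodBernoulli p).real (W₁ ∩ W₃) * (prodBernoulli p).real (W₁ ∩ W₂) := by ring
    _ ≤ (∏ e ∈ g, (p e : ℝ)) ^ (3 - 1) := key
    _ = (∏ e ∈ g, (p e : ℝ)) ^ 2 := by norm_num

/-! ## Sunflowers with principal core: Lemma A and the law-level rows -/

/-- **Lemma A for principal-core sunflowers.**  Three up-sets with all pairwise intersections equal to the principal filter
`A = {g ⊆ ω}`: `μ(E₁) μ(E₂) μ(E₃) ≤ μ(A)²` ("one sample in each `E_i` is at most as likely as two samples in the core"),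
for EVERY product measure — on this stratum the density hypothesis `a ≥ b` of (C1-law) is not needed. [this work] -/
theorem lemmaA_of_principalCore (p : ι → unitInterval) {E₁ E₂ E₃ A : Set (Set ι)} (h₁ : IsUpperSet E₁) (h₂ : IsUpperSet E₂)
    (h₃ : IsUpperSet E₃) (h12 : E₁ ∩ E₂ = A) (h13 : E₁ ∩ E₃ = A) (h23 : E₂ ∩ E₃ = A) (g : Finset ι)
    (hA : A = {ω | (g : Set ι) ⊆ ω}) :
    (prodBernoulli p).real E₁ * (prodBernoulli p).real E₂ * (prodBernoulli p).real E₃ ≤ ((prodBernoulli p).real A) ^ 2 := by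
  let V : Fin 3 → Set (Set ι) := ![E₁, E₂, E₃]
  have hV : ∀ i, IsUpperSet (V i) := by
    intro i; fin_cases i
    · exact h₁
    · exact h₂
    · exact h₃
  have hcap' : ∀ i j, i ≠ j → V i ∩ V j ⊆ {ω | (g : Set ι) ⊆ ω} := by
    intro i j hij
    rw [← hA]
    fin_cases i <;> fin_cases j
    all_goals first
      | exact (hij rfl).elim
      | (change E₁ ∩ E₂ ⊆ A; exact h12.le)
      | (change E₂ ∩ E₁ ⊆ A; rw [Set.inter_comm]; exact h12.le)
      | (change E₁ ∩ E₃ ⊆ A; exact h13.le)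
      | (change E₃ ∩ E₁ ⊆ A; rw [Set.inter_comm]; exact h13.le)
      | (change E₂ ∩ E₃ ⊆ A; exact h23.le)
      | (change E₃ ∩ E₂ ⊆ A; rw [Set.inter_comm]; exact h23.le)
  have key := prod_real_le_real_core_pow p hV g hcap'
  rw [Fin.prod_univ_three, ← hA] at key
  simp only [V, Matrix.cons_val_zero, Matrix.cons_val_one, Matrix.cons_val, Fintype.card_fin] at key
  calc (prodBernoulli p).real E₁ * (prodBernoulli p).real E₂ * (prodBernoulli p).real E₃
      ≤ ((prodBernoulli p).real A) ^ (3 - 1) := key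
    _ = ((prodBernoulli p).real A) ^ 2 := by norm_num

section Cells

variable [Finite ι]

/-- Cell bookkeeping for a three-petal sunflower of a finite cube: `μ(E_i) = a + c_i` and `b = 1 − a − c₁ − c₂ − c₃`. [this work] -/
theorem cells_eq (p : ι → unitInterval) {E₁ E₂ E₃ A : Set (Set ι)}
    (h12 : E₁ ∩ E₂ = A) (h13 : E₁ ∩ E₃ = A) (h23 : E₂ ∩ E₃ = A) :
    (prodBernoulli p).real E₁ = (prodBernoulli p).real A + (prodBernoulli p).real (E₁ \ A) ∧
    (prodBernoulli p).real E₂ = (prodBernoulli p).real A + (prodBernoulli p).real (E₂ \ A) ∧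
    (prodBernoulli p).real E₃ = (prodBernoulli p).real A + (prodBernoulli p).real (E₃ \ A) ∧
    (prodBernoulli p).real (E₁ ∪ E₂ ∪ E₃)ᶜ = 1 - (prodBernoulli p).real A - (prodBernoulli p).real (E₁ \ A)
      - (prodBernoulli p).real (E₂ \ A) - (prodBernoulli p).real (E₃ \ A) := by
  classical
  have m₁ : MeasurableSet E₁ := MeasurableSet.of_discrete
  have m₂ : MeasurableSet E₂ := MeasurableSet.of_discrete
  have m₃ : MeasurableSet E₃ := MeasurableSet.of_discrete
  have hA : MeasurableSet A := by rw [← h12]; exact m₁.inter m₂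
  have hAU₁ : E₁ ∩ A = A := by
    rw [Set.inter_eq_right, ← h12]; exact Set.inter_subset_left
  have hAU₂ : E₂ ∩ A = A := by
    rw [Set.inter_eq_right, ← h12]; exact Set.inter_subset_right
  have hAU₃ : E₃ ∩ A = A := by
    rw [Set.inter_eq_right, ← h13]; exact Set.inter_subset_right
  have d₁ := measureReal_inter_add_sdiff (μ := prodBernoulli p) (s := E₁) hA
  have d₂ := measureReal_inter_add_sdiff (μ := prodBernoulli p) (s := E₂) hA
  have d₃ := measureReal_inter_add_sdiff (μ := prodBernoulli p) (s := E₃) hA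
  rw [hAU₁] at d₁
  rw [hAU₂] at d₂
  rw [hAU₃] at d₃
  have hU123 := measureReal_union₃_of_pairwise_inter_eq (prodBernoulli p) m₂ m₃ h12 h13 h23
  have cB : (prodBernoulli p).real (E₁ ∪ E₂ ∪ E₃)ᶜ = 1 - (prodBernoulli p).real (E₁ ∪ E₂ ∪ E₃) :=
    probReal_compl_eq_one_sub ((m₁.union m₂).union m₃)
  refine ⟨by linarith, by linarith, by linarith, ?_⟩
  rw [cB, hU123]
  linarith

/-- **Lemma A in cells** for a principal-core sunflower of a finite cube: `c₁c₂c₃ ≤ a·(ab − (c₁c₂ + c₁c₃ + c₂c₃))`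
(`a(ab − e₂) − e₃ = a² − Π(a + c_i)` since `b = 1 − a − Σ c_i`). [this work] -/
theorem e3_le_core_mul_AG (p : ι → unitInterval) {E₁ E₂ E₃ A : Set (Set ι)} (h₁ : IsUpperSet E₁) (h₂ : IsUpperSet E₂)
    (h₃ : IsUpperSet E₃) (h12 : E₁ ∩ E₂ = A) (h13 : E₁ ∩ E₃ = A) (h23 : E₂ ∩ E₃ = A) (g : Finset ι)
    (hA : A = {ω | (g : Set ι) ⊆ ω}) :
    (prodBernoulli p).real (E₁ \ A) * (prodBernoulli p).real (E₂ \ A) * (prodBernoulli p).real (E₃ \ A) ≤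
      (prodBernoulli p).real A * ((prodBernoulli p).real A * (prodBernoulli p).real (E₁ ∪ E₂ ∪ E₃)ᶜ -
        ((prodBernoulli p).real (E₁ \ A) * (prodBernoulli p).real (E₂ \ A) +
          (prodBernoulli p).real (E₁ \ A) * (prodBernoulli p).real (E₃ \ A) +
          (prodBernoulli p).real (E₂ \ A) * (prodBernoulli p).real (E₃ \ A))) := by
  have key := lemmaA_of_principalCore p h₁ h₂ h₃ h12 h13 h23 g hA
  obtain ⟨e₁, e₂, e₃, eB⟩ := cells_eq p h12 h13 h23
  rw [e₁, e₂, e₃] at key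
  rw [eB]
  nlinarith [key]

/-- **(C1-law) on the principal-core stratum**: `e₃ ≤ max(a,b)·(ab − e₂)`, unconditionally. [this work] -/
theorem e3_le_max_mul_AG (p : ι → unitInterval) {E₁ E₂ E₃ A : Set (Set ι)} (h₁ : IsUpperSet E₁) (h₂ : IsUpperSet E₂)
    (h₃ : IsUpperSet E₃) (h12 : E₁ ∩ E₂ = A) (h13 : E₁ ∩ E₃ = A) (h23 : E₂ ∩ E₃ = A) (g : Finset ι)
    (hA : A = {ω | (g : Set ι) ⊆ ω}) :
    (prodBernoulli p).real (E₁ \ A) * (prodBernoulli p).real (E₂ \ A) * (prodBernoulli p).real (E₃ \ A) ≤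
      max ((prodBernoulli p).real A) ((prodBernoulli p).real (E₁ ∪ E₂ ∪ E₃)ᶜ) *
        ((prodBernoulli p).real A * (prodBernoulli p).real (E₁ ∪ E₂ ∪ E₃)ᶜ -
          ((prodBernoulli p).real (E₁ \ A) * (prodBernoulli p).real (E₂ \ A) +
            (prodBernoulli p).real (E₁ \ A) * (prodBernoulli p).real (E₃ \ A) +
            (prodBernoulli p).real (E₂ \ A) * (prodBernoulli p).real (E₃ \ A))) := by
  have hLA := e3_le_core_mul_AG p h₁ h₂ h₃ h12 h13 h23 g hA
  have hAG := prodBernoulli_strongHarris_sunflower_three p h₁ h₂ h₃ h12 h13 h23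
  have hmax : (prodBernoulli p).real A ≤ max ((prodBernoulli p).real A) ((prodBernoulli p).real (E₁ ∪ E₂ ∪ E₃)ᶜ) :=
    le_max_left _ _
  nlinarith [hmax, hAG, hLA]

/-- **The `H`-row on the principal-core stratum**: `(a + b)(ab − e₂) ≥ e₃`, unconditionally (the tree has it for every sunflower
only modulo `PartitionLemmaH`, `lawH_real_nonneg_of_partitionLemmaH`). [this work] -/
theorem lawH_nonneg (p : ι → unitInterval) {E₁ E₂ E₃ A : Set (Set ι)} (h₁ : IsUpperSet E₁) (h₂ : IsUpperSet E₂)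
    (h₃ : IsUpperSet E₃) (h12 : E₁ ∩ E₂ = A) (h13 : E₁ ∩ E₃ = A) (h23 : E₂ ∩ E₃ = A) (g : Finset ι)
    (hA : A = {ω | (g : Set ι) ⊆ ω}) :
    0 ≤ ((prodBernoulli p).real A + (prodBernoulli p).real (E₁ ∪ E₂ ∪ E₃)ᶜ) *
        ((prodBernoulli p).real A * (prodBernoulli p).real (E₁ ∪ E₂ ∪ E₃)ᶜ -
          ((prodBernoulli p).real (E₁ \ A) * (prodBernoulli p).real (E₂ \ A) +
            (prodBernoulli p).real (E₁ \ A) * (prodBernoulli p).real (E₃ \ A) +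
            (prodBernoulli p).real (E₂ \ A) * (prodBernoulli p).real (E₃ \ A))) -
      (prodBernoulli p).real (E₁ \ A) * (prodBernoulli p).real (E₂ \ A) * (prodBernoulli p).real (E₃ \ A) := by
  have hLA := e3_le_core_mul_AG p h₁ h₂ h₃ h12 h13 h23 g hA
  have hAG := prodBernoulli_strongHarris_sunflower_three p h₁ h₂ h₃ h12 h13 h23
  have hb : 0 ≤ (prodBernoulli p).real (E₁ ∪ E₂ ∪ E₃)ᶜ := measureReal_nonneg
  nlinarith [hb, hAG, hLA]

/-- **The `G`-row on the principal-core stratum**: `ab − e₂ ≥ e₃` (from Lemma A and `a ≤ 1`). [this work] -/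
theorem AG_ge_e3 (p : ι → unitInterval) {E₁ E₂ E₃ A : Set (Set ι)} (h₁ : IsUpperSet E₁) (h₂ : IsUpperSet E₂)
    (h₃ : IsUpperSet E₃) (h12 : E₁ ∩ E₂ = A) (h13 : E₁ ∩ E₃ = A) (h23 : E₂ ∩ E₃ = A) (g : Finset ι)
    (hA : A = {ω | (g : Set ι) ⊆ ω}) :
    (prodBernoulli p).real (E₁ \ A) * (prodBernoulli p).real (E₂ \ A) * (prodBernoulli p).real (E₃ \ A) ≤
      (prodBernoulli p).real A * (prodBernoulli p).real (E₁ ∪ E₂ ∪ E₃)ᶜ -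
        ((prodBernoulli p).real (E₁ \ A) * (prodBernoulli p).real (E₂ \ A) +
          (prodBernoulli p).real (E₁ \ A) * (prodBernoulli p).real (E₃ \ A) +
          (prodBernoulli p).real (E₂ \ A) * (prodBernoulli p).real (E₃ \ A)) := by
  have hLA := e3_le_core_mul_AG p h₁ h₂ h₃ h12 h13 h23 g hA
  have hAG := prodBernoulli_strongHarris_sunflower_three p h₁ h₂ h₃ h12 h13 h23
  have ha1 : (prodBernoulli p).real A ≤ 1 := measureReal_le_one
  have ha0 : 0 ≤ (prodBernoulli p).real A := measureReal_nonneg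
  nlinarith [ha1, ha0, hAG, hLA]

/-- **Kahn's Conjecture 5 / Sahi `E₃ ≥ 0` for the complements of a principal-core sunflower of up-sets.**
`E₃(E₁ᶜ, E₂ᶜ, E₃ᶜ) = (1 + a)(ab − e₂) − e₃ ≥ a(ab − e₂) − e₃ ≥ 0` — the `T`-row; the tree had `≥ −e₃` for every sunflower
(`prodBernoulli_sahiE3_compl_sunflower_ge`) and `≥ 0` modulo `PartitionLemmaH`. [this work] -/
theorem sahiE3_compl_nonneg_of_principalCore (p : ι → unitInterval) {E₁ E₂ E₃ A : Set (Set ι)} (h₁ : IsUpperSet E₁)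
    (h₂ : IsUpperSet E₂) (h₃ : IsUpperSet E₃) (h12 : E₁ ∩ E₂ = A) (h13 : E₁ ∩ E₃ = A) (h23 : E₂ ∩ E₃ = A)
    (g : Finset ι) (hA : A = {ω | (g : Set ι) ⊆ ω}) :
    0 ≤ sahiE3 (prodBernoulli p) E₁ᶜ E₂ᶜ E₃ᶜ := by
  classical
  have m₁ : MeasurableSet E₁ := MeasurableSet.of_discrete
  have m₂ : MeasurableSet E₂ := MeasurableSet.of_discrete
  have m₃ : MeasurableSet E₃ := MeasurableSet.of_discrete
  rw [sahiE3_compl_sunflower_eq (prodBernoulli p) m₁ m₂ m₃ h12 h13 h23]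
  have hLA := e3_le_core_mul_AG p h₁ h₂ h₃ h12 h13 h23 g hA
  have hAG := prodBernoulli_strongHarris_sunflower_three p h₁ h₂ h₃ h12 h13 h23
  have ha0 : 0 ≤ (prodBernoulli p).real A := measureReal_nonneg
  nlinarith [ha0, hAG, hLA]

end Cells

end PrincipalCore

end Summit.CriticalPhenomena.PercolationContinuityZ3.Theorems.SunflowerPartition
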